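import Mathlib
import Summits.Ventures.PercRepro.RankLevelSetTriangleStar
import Summits.Ventures.PercRepro.TriangleCapMatroidReduction

/-!
# PercRepro — the Δ-form of the cocircuit gain bound: the weakest hypothesis the induction uses (p3, gen 25)

The induction of `TriangleCapMatroidReduction` restricts a finite matroid `M` of the class `Core3` to the
hyperplane `M.E \ K` of a cocircuit `K` (`d = |K|`, nullity `ν − (d − 1)`) and needs only
`gain M K ≤ P ν − P (ν − (d − 1))` — the **Δ-form** — to close; the `min (C(d,2)) ν` form of
`ExistsGoodCocircuit` implies it through `KK.L2'`.  The Δ-form is strictly weaker: the minimum-cocircuit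
`min`-form is FALSE (P3-TRIANGLE-CAP.md §10q: `M(K₆)` plus three generic points of the hyperplane
`{Σx = 0, x₀ + x₁ = 0}` has a minimum cocircuit with gain `16 > min (28) 13`), while the Δ-form holds there with
equality (`16 = P 13 − P 6`).

* `ExistsDeltaCocircuit α` — every finite matroid of the class with a triangle has a cocircuit `K` with
  `gain M K ≤ P ν − P (ν − (|K| − 1))`;
* `MinCocircuitDeltaBound α` — the same at every cocircuit of minimum size (the repaired candidate);
* `existsDeltaCocircuit_of_existsGoodCocircuit` — the `min`-form implies the Δ-form (`KK.L2'`);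
* **`ncard_triangles_le_P_of_existsDeltaCocircuit`** — `ExistsDeltaCocircuit α → T(M) ≤ P_KK ν`;
* `existsDeltaCocircuit_of_minCocircuitDeltaBound`, `ncard_triangles_le_P_of_minCocircuitDeltaBound`.
Both closed-form theorems are CONDITIONAL on their named hypothesis by construction. Axioms: standard.
-/

open scoped Matroid

namespace PercRepro

namespace TriangleCap

namespace Cocirc

open Set

variable {α : Type}

/-- The Δ-form existence hypothesis: some cocircuit `K` has `gain M K ≤ P ν − P (ν − (|K| − 1))`. -/
def ExistsDeltaCocircuit (α : Type) : Prop :=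
  ∀ (M : Matroid α) [M.Finite], Core3 M → (ThmN.triangles M).Nonempty →
    ∀ ν : ℕ, M.E.encard = M.eRank + ν →
      ∃ K : Set α, M.IsCocircuit K ∧ gain M K ≤ KK.P ν - KK.P (ν - (K.ncard - 1))

/-- The Δ-form at every cocircuit of minimum size (the repaired candidate lemma). -/
def MinCocircuitDeltaBound (α : Type) : Prop :=
  ∀ (M : Matroid α) [M.Finite], Core3 M → ∀ K : Set α, M.IsCocircuit K →
    (∀ K' : Set α, M.IsCocircuit K' → K.ncard ≤ K'.ncard) →
    ∀ ν : ℕ, M.E.encard = M.eRank + ν → gain M K ≤ KK.P ν - KK.P (ν - (K.ncard - 1))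

/-- For a cocircuit `K` of a finite matroid with `|E| = r(E) + ν`: `1 ≤ |K|` and `|K| − 1 ≤ ν`
(the complement has rank `r − 1`, hence at least `r − 1` elements). -/
theorem one_le_ncard_and_sub_one_le_nullity (M : Matroid α) [M.Finite] {K : Set α}
    (hK : M.IsCocircuit K) {ν : ℕ} (hν : M.E.encard = M.eRank + ν) :
    1 ≤ K.ncard ∧ K.ncard - 1 ≤ ν := by
  have hHE : M.E \ K ⊆ M.E := sdiff_subset
  have hKE : K ⊆ M.E := hK.subset_ground
  have hEfin := M.ground_finite
  have hHfin : (M.E \ K).Finite := hEfin.subset hHE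
  have hKfin : K.Finite := hEfin.subset hKE
  have hrk := eRk_compl_add_one_eq_eRank M hK
  have hRne : M.eRank ≠ ⊤ := ((M.eRank_le_encard_ground).trans_lt hEfin.encard_lt_top).ne
  obtain ⟨r, hr⟩ := ENat.ne_top_iff_exists.1 hRne
  have hrne : M.eRk (M.E \ K) ≠ ⊤ := ((M.eRk_le_encard _).trans_lt hHfin.encard_lt_top).ne
  obtain ⟨rH, hrH⟩ := ENat.ne_top_iff_exists.1 hrne
  have hEcard : M.E.encard = (M.E \ K).encard + K.encard := by
    rw [← encard_union_eq disjoint_sdiff_left, sdiff_union_of_subset hKE]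
  have hrHle : M.eRk (M.E \ K) ≤ (M.E \ K).encard := M.eRk_le_encard _
  rw [← hr, ← hrH] at hrk
  rw [← hr, hEcard, ← hHfin.cast_ncard_eq, ← hKfin.cast_ncard_eq] at hν
  rw [← hrH, ← hHfin.cast_ncard_eq] at hrHle
  have hrk' : rH + 1 = r := by exact_mod_cast hrk
  have hν' : (M.E \ K).ncard + K.ncard = r + ν := by exact_mod_cast hν
  have hrHle' : rH ≤ (M.E \ K).ncard := by exact_mod_cast hrHle
  have hd1 : 1 ≤ K.ncard := (ncard_pos hKfin).2 hK.nonempty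
  exact ⟨hd1, by omega⟩

/-- The `min`-form implies the Δ-form (`KK.L2'`). -/
theorem existsDeltaCocircuit_of_existsGoodCocircuit (h : ExistsGoodCocircuit α) :
    ExistsDeltaCocircuit α := by
  intro M _ hM hT ν hν
  obtain ⟨K, hK, hg⟩ := h M hM hT ν hν
  obtain ⟨hd1, hdν⟩ := one_le_ncard_and_sub_one_le_nullity M hK hν
  refine ⟨K, hK, ?_⟩
  have := KK.L2' K.ncard ν hd1 hdν
  omega

/-- **The reduction in Δ-form.** If every finite matroid of the class with a triangle has a cocircuit `K`
with `gain M K ≤ P ν − P (ν − (|K| − 1))`, then every finite matroid of the class with `|E| = r(E) + ν` has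
at most `P_KK ν` triangles. -/
theorem ncard_triangles_le_P_of_existsDeltaCocircuit (hGB : ExistsDeltaCocircuit α)
    (M : Matroid α) [M.Finite] (hM : Core3 M) {ν : ℕ} (hν : M.E.encard = M.eRank + ν) :
    (ThmN.triangles M).ncard ≤ KK.P ν := by
  suffices H : ∀ n : ℕ, ∀ (M : Matroid α) [M.Finite], M.E.ncard = n → Core3 M →
      ∀ ν : ℕ, M.E.encard = M.eRank + ν → (ThmN.triangles M).ncard ≤ KK.P ν from
    H _ M rfl hM ν hν
  intro n
  induction n using Nat.strong_induction_on with
  | _ n ih =>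
  intro M _ hn hM ν hν
  by_cases hT : (ThmN.triangles M).Nonempty
  swap
  · rw [Set.not_nonempty_iff_eq_empty] at hT
    rw [hT, ncard_empty]
    exact Nat.zero_le _
  obtain ⟨K, hK, hg⟩ := hGB M hM hT ν hν
  have hHE : M.E \ K ⊆ M.E := sdiff_subset
  have hKE : K ⊆ M.E := hK.subset_ground
  have hEfin := M.ground_finite
  have hHfin : (M.E \ K).Finite := hEfin.subset hHE
  have hKfin : K.Finite := hEfin.subset hKE
  haveI : (M ↾ (M.E \ K)).Finite := Matroid.restrict_finite hHfin
  have hrk := eRk_compl_add_one_eq_eRank M hK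
  have hRne : M.eRank ≠ ⊤ := ((M.eRank_le_encard_ground).trans_lt hEfin.encard_lt_top).ne
  obtain ⟨r, hr⟩ := ENat.ne_top_iff_exists.1 hRne
  have hrne : M.eRk (M.E \ K) ≠ ⊤ := ((M.eRk_le_encard _).trans_lt hHfin.encard_lt_top).ne
  obtain ⟨rH, hrH⟩ := ENat.ne_top_iff_exists.1 hrne
  have hEcard : M.E.encard = (M.E \ K).encard + K.encard := by
    rw [← encard_union_eq disjoint_sdiff_left, sdiff_union_of_subset hKE]
  have hrHle : M.eRk (M.E \ K) ≤ (M.E \ K).encard := M.eRk_le_encard _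
  rw [← hr, ← hrH] at hrk
  rw [← hr, hEcard, ← hHfin.cast_ncard_eq, ← hKfin.cast_ncard_eq] at hν
  rw [← hrH, ← hHfin.cast_ncard_eq] at hrHle
  have hrk' : rH + 1 = r := by exact_mod_cast hrk
  have hν' : (M.E \ K).ncard + K.ncard = r + ν := by exact_mod_cast hν
  have hrHle' : rH ≤ (M.E \ K).ncard := by exact_mod_cast hrHle
  have hd1 : 1 ≤ K.ncard := (ncard_pos hKfin).2 hK.nonempty
  have hν2 : (M ↾ (M.E \ K)).E.encard = (M ↾ (M.E \ K)).eRank + ((ν - (K.ncard - 1) : ℕ) : ℕ∞) := by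
    rw [Matroid.restrict_ground_eq, Matroid.eRank_restrict, ← hrH, ← hHfin.cast_ncard_eq]
    have : (M.E \ K).ncard = rH + (ν - (K.ncard - 1)) := by omega
    rw [this]
    push_cast
    rfl
  have hlt : (M.E \ K).ncard < n := by
    rw [← hn]
    exact ncard_lt_ncard (hKE.sdiff_ssubset_of_nonempty hK.nonempty) hEfin
  have ih' := ih _ hlt (M ↾ (M.E \ K)) rfl (hM.restrict hHE) _ hν2
  rw [ncard_triangles_eq_restrict_add_gain M K]
  have hmono : KK.P (ν - (K.ncard - 1)) ≤ KK.P ν := KK.P_mono (Nat.sub_le _ _)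
  omega

/-- The Δ-form at minimum cocircuits supplies the Δ-form cocircuit (a minimum cocircuit exists as soon as
there is a triangle). -/
theorem existsDeltaCocircuit_of_minCocircuitDeltaBound (h : MinCocircuitDeltaBound α) :
    ExistsDeltaCocircuit α := by
  intro M _ hM hT ν hν
  obtain ⟨C, hC⟩ := hT
  obtain ⟨K, hK, hKmin⟩ := exists_min_cocircuit M (exists_cocircuit_of_triangle M hC)
  exact ⟨K, hK, h M hM K hK hKmin ν hν⟩

/-- **CONJECTURE 10b modulo the Δ-form at minimum cocircuits.** -/
theorem ncard_triangles_le_P_of_minCocircuitDeltaBound (hGB : MinCocircuitDeltaBound α)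
    (M : Matroid α) [M.Finite] (hM : Core3 M) {ν : ℕ} (hν : M.E.encard = M.eRank + ν) :
    (ThmN.triangles M).ncard ≤ KK.P ν :=
  ncard_triangles_le_P_of_existsDeltaCocircuit (existsDeltaCocircuit_of_minCocircuitDeltaBound hGB) M hM hν

end Cocirc

end TriangleCap

end PercRepro
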